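import Literature.NumberTheory.EllipticCurves.TwoAdicImageSurjectivityModTwoProofs
import Literature.NumberTheory.GaloisRepresentations.ModNCyclotomicCharacter
import Literature.NumberTheory.GaloisRepresentations.TateLevelOneWildOdd
import Literature.NumberTheory.DiophantineGeometry.GenEllLAdicImageSurjective
import Literature.NumberTheory.Automorphic.QuadraticCharacterTwist
import HarnessLib

/-!
# The `ℚ → K` transfer of `2`-power surjectivity, I: over a quadratic field `K` with `2 ∤ d_K` and
# `√Δ, √−Δ, √2Δ, √−2Δ ∉ K`, some element of `Gal(ℚ̄/K)` acts on `E[2]` as a transposition and fixes `ζ₈`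

Route `GenusKolyvaginAtTwo` (BirchSwinnertonDyer), seat `bsd-line-gk2-p3` g15 (cell `bsd-f1-sign2`),
`--supports stmt-BirchSwinnertonDyer-28029` (helper; closes nothing). THEOREMS ONLY (no definition, no named
fact, no `sorry`). BSD is not proved by any of this.

For an elliptic curve `E/ℚ` (any model `W`) and a quadratic number field `K`, write `H = Gal(ℚ̄/K) ≤ Γ_ℚ`
(the range of the restriction `Γ_K → Γ_ℚ`), `χ₈ : Γ_ℚ → (ℤ/8)ˣ` for the mod-`8` cyclotomic character,
`δ = (x₀−x₁)(x₀−x₂)(x₁−x₂)` (`16δ² = Δ`, `σδ = sign(σ|E[2]) δ`, tree `DokchitserDokchitser2012.delta`) and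
`ζ₈ ∈ ℚ̄` for a primitive eighth root of unity (`ζ₈² = i`, `ζ₈ + ζ₈⁷ = √2`, `ζ₈ + ζ₈³ = √−2`).

* §1 `ℚ̄`-arithmetic of `ζ₈`: `ζ₈⁴ = −1`; the action of `σ` on `ζ₈², ζ₈+ζ₈⁷, ζ₈+ζ₈³` read off `χ₈(σ) ∈ {1,3,5,7}`.
* §2 an element of `ℚ̄` with rational square `m`, fixed by all of `H`, makes `m` a square in `K`
  (`isSquare_algebraMap_of_forall_smul_eq`; Galois descent in `K̄/K` along the chosen embedding `ℚ̄ → K̄`).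
* §3 **`exists_sign_permGal_eq_neg_one_and_cyclotomic_eq_one`**: if `2 ∤ d_K` (so `χ₈(H) = (ℤ/8)ˣ`, tree
  `modNCyclotomicCharacter_surjective_of_forall_prime_dvd_not_dvd_discr`) and none of `Δ, −Δ, 2Δ, −2Δ` is a
  square in `K`, then some `h ∈ H` acts on `E[2] ∖ 0` by a transposition (`sign = −1`) with `χ₈(h) = 1`.
  Proof: otherwise `sign|_H` factors through `χ₈|_H`, i.e. equals one of the four characters `1`, `ε₋₁`,
  `ε₂`, `ε₋₂` of `(ℤ/8)ˣ`, and then every `h ∈ H` fixes `4δ`, `4δ·ζ₈²`, `4δ(ζ₈+ζ₈⁷)` or `4δ(ζ₈+ζ₈³)` —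
  square roots of `Δ, −Δ, 2Δ, −2Δ` — contradicting §2.
The sequel (`…TwoPowerImageOverK.lean`) feeds this witness to the group theory of
`…TwoPowerImageOverKGroup.lean` and concludes `(W.baseChange K).HasSurjectiveModNGaloisRep (2^n)`.

References: [Serre1972] §5.3; [RouseZureickbrown2015] §3; [DokchitserDokchitserMathZ2012] Thm. (1) and proof.
-/

set_option autoImplicit false
set_option linter.dupNamespace false

noncomputable section

open scoped Classical

namespace Summit.BirchSwinnertonDyer.BirchSwinnertonDyer.Theorems.GenusExact.TwoPowerImageOverK

open WeierstrassCurve Field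
open Literature.NumberTheory.EllipticCurves Literature.NumberTheory.GaloisRepresentations
open Literature.NumberTheory.EllipticCurves.DokchitserDokchitser2012

/-! ## §1 Arithmetic of a primitive eighth root of unity in `ℚ̄` -/

section Zeta

variable {ζ : AlgebraicClosure ℚ} (hζ : IsPrimitiveRoot ζ 8)

include hζ in
/-- `ζ₈⁴ = −1`. [folklore] -/
private theorem zeta_pow_four : ζ ^ 4 = -1 := by
  have h8 : ζ ^ 4 * ζ ^ 4 = 1 := by rw [← pow_add]; exact hζ.pow_eq_one
  have h4 : ζ ^ 4 ≠ 1 := hζ.pow_ne_one_of_pos_of_lt (by norm_num) (by norm_num)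
  rcases mul_self_eq_one_iff.mp h8 with h | h
  · exact absurd h h4
  · exact h

include hζ in
/-- Reduction of exponents modulo `8`. [folklore] -/
private theorem zeta_pow_mod (n : ℕ) : ζ ^ n = ζ ^ (n % 8) := by
  conv_lhs => rw [← Nat.div_add_mod n 8, pow_add, pow_mul, hζ.pow_eq_one, one_pow, one_mul]

/-- `σ ∈ Γ_ℚ` acts on any eighth root of unity `t` by `t ↦ t^a` where `a` is any natural number
representing `χ₈(σ)`. [folklore] -/
private theorem smul_eq_pow_of_cyclotomic (σ : absoluteGaloisGroup ℚ) {a : ℕ}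
    (ha : ((modNCyclotomicCharacter ℚ 8 σ : (ZMod 8)ˣ) : ZMod 8) = a) (t : AlgebraicClosure ℚ)
    (ht : t ^ 8 = 1) : σ • t = t ^ a := by
  haveI : NeZero ((8 : ℕ) : ℚ) := ⟨by norm_num⟩
  rw [modNCyclotomicCharacter_spec ℚ 8 σ t ht, ha, ZMod.val_natCast]
  conv_rhs => rw [← Nat.div_add_mod a 8, pow_add, pow_mul, ht, one_pow, one_mul]

include hζ in
/-- The units of `ℤ/8` are `1, 3, 5, 7`; the action on `ζ₈², ζ₈ + ζ₈⁷ (= √2), ζ₈ + ζ₈³ (= √−2)`: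
`χ₈ = 1` fixes all three. [folklore] -/
private theorem smul_gens_one (σ : absoluteGaloisGroup ℚ)
    (h : ((modNCyclotomicCharacter ℚ 8 σ : (ZMod 8)ˣ) : ZMod 8) = 1) :
    σ • ζ ^ 2 = ζ ^ 2 ∧ σ • (ζ + ζ ^ 7) = ζ + ζ ^ 7 ∧ σ • (ζ + ζ ^ 3) = ζ + ζ ^ 3 := by
  have h1 : ((modNCyclotomicCharacter ℚ 8 σ : (ZMod 8)ˣ) : ZMod 8) = ((1 : ℕ) : ZMod 8) := by
    rw [h, Nat.cast_one]
  have hz : σ • ζ = ζ ^ 1 := smul_eq_pow_of_cyclotomic σ h1 ζ hζ.pow_eq_one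
  rw [pow_one] at hz
  refine ⟨?_, ?_, ?_⟩ <;> simp only [smul_pow', smul_add, hz]

include hζ in
/-- `χ₈ = 3`: `ζ₈² ↦ −ζ₈²`, `√2 ↦ −√2`, `√−2 ↦ √−2`. [folklore] -/
private theorem smul_gens_three (σ : absoluteGaloisGroup ℚ)
    (h : ((modNCyclotomicCharacter ℚ 8 σ : (ZMod 8)ˣ) : ZMod 8) = 3) :
    σ • ζ ^ 2 = -ζ ^ 2 ∧ σ • (ζ + ζ ^ 7) = -(ζ + ζ ^ 7) ∧ σ • (ζ + ζ ^ 3) = ζ + ζ ^ 3 := by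
  have h1 : ((modNCyclotomicCharacter ℚ 8 σ : (ZMod 8)ˣ) : ZMod 8) = ((3 : ℕ) : ZMod 8) := by
    rw [h, Nat.cast_ofNat]
  have hz : σ • ζ = ζ ^ 3 := smul_eq_pow_of_cyclotomic σ h1 ζ hζ.pow_eq_one
  have h4 := zeta_pow_four hζ
  have h8 : ζ ^ 8 = 1 := hζ.pow_eq_one
  refine ⟨?_, ?_, ?_⟩ <;> simp only [smul_pow', smul_add, hz, ← pow_mul]
  · norm_num; linear_combination ζ ^ 2 * h4
  · norm_num
    rw [zeta_pow_mod hζ 21]; norm_num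
    linear_combination (ζ + ζ ^ 3) * h4
  · norm_num
    rw [zeta_pow_mod hζ 9]; norm_num
    ring

include hζ in
/-- `χ₈ = 5`: `ζ₈² ↦ ζ₈²`, `√2 ↦ −√2`, `√−2 ↦ −√−2`. [folklore] -/
private theorem smul_gens_five (σ : absoluteGaloisGroup ℚ)
    (h : ((modNCyclotomicCharacter ℚ 8 σ : (ZMod 8)ˣ) : ZMod 8) = 5) :
    σ • ζ ^ 2 = ζ ^ 2 ∧ σ • (ζ + ζ ^ 7) = -(ζ + ζ ^ 7) ∧ σ • (ζ + ζ ^ 3) = -(ζ + ζ ^ 3) := by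
  have h1 : ((modNCyclotomicCharacter ℚ 8 σ : (ZMod 8)ˣ) : ZMod 8) = ((5 : ℕ) : ZMod 8) := by
    rw [h, Nat.cast_ofNat]
  have hz : σ • ζ = ζ ^ 5 := smul_eq_pow_of_cyclotomic σ h1 ζ hζ.pow_eq_one
  have h4 := zeta_pow_four hζ
  have h8 : ζ ^ 8 = 1 := hζ.pow_eq_one
  refine ⟨?_, ?_, ?_⟩ <;> simp only [smul_pow', smul_add, hz, ← pow_mul]
  · norm_num
    rw [zeta_pow_mod hζ 10]
  · norm_num
    rw [zeta_pow_mod hζ 35]; norm_num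
    linear_combination (ζ + ζ ^ 3) * h4
  · norm_num
    rw [zeta_pow_mod hζ 15]; norm_num
    linear_combination (ζ + ζ ^ 3) * h4

include hζ in
/-- `χ₈ = 7` (complex-conjugation class): `ζ₈² ↦ −ζ₈²`, `√2 ↦ √2`, `√−2 ↦ −√−2`. [folklore] -/
private theorem smul_gens_seven (σ : absoluteGaloisGroup ℚ)
    (h : ((modNCyclotomicCharacter ℚ 8 σ : (ZMod 8)ˣ) : ZMod 8) = 7) :
    σ • ζ ^ 2 = -ζ ^ 2 ∧ σ • (ζ + ζ ^ 7) = ζ + ζ ^ 7 ∧ σ • (ζ + ζ ^ 3) = -(ζ + ζ ^ 3) := by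
  have h1 : ((modNCyclotomicCharacter ℚ 8 σ : (ZMod 8)ˣ) : ZMod 8) = ((7 : ℕ) : ZMod 8) := by
    rw [h, Nat.cast_ofNat]
  have hz : σ • ζ = ζ ^ 7 := smul_eq_pow_of_cyclotomic σ h1 ζ hζ.pow_eq_one
  have h4 := zeta_pow_four hζ
  have h8 : ζ ^ 8 = 1 := hζ.pow_eq_one
  refine ⟨?_, ?_, ?_⟩ <;> simp only [smul_pow', smul_add, hz, ← pow_mul]
  · norm_num
    rw [zeta_pow_mod hζ 14]; norm_num
    linear_combination ζ ^ 2 * h4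
  · norm_num
    rw [zeta_pow_mod hζ 49]; norm_num
    ring
  · norm_num
    rw [zeta_pow_mod hζ 21]; norm_num
    linear_combination (ζ + ζ ^ 3) * h4

include hζ in
/-- Squares: `(ζ₈²)² = −1`, `(ζ₈ + ζ₈⁷)² = 2`, `(ζ₈ + ζ₈³)² = −2`. [folklore] -/
private theorem gens_sq :
    (ζ ^ 2) ^ 2 = -1 ∧ (ζ + ζ ^ 7) ^ 2 = 2 ∧ (ζ + ζ ^ 3) ^ 2 = -2 := by
  have h4 := zeta_pow_four hζ
  have h8 : ζ ^ 8 = 1 := hζ.pow_eq_one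
  refine ⟨?_, ?_, ?_⟩
  · rw [← pow_mul]; exact h4
  · have e : (ζ + ζ ^ 7) ^ 2 = ζ ^ 2 + 2 * ζ ^ 8 + ζ ^ 8 * ζ ^ 6 := by ring
    rw [e, h8]
    linear_combination ζ ^ 2 * h4
  · have e : (ζ + ζ ^ 3) ^ 2 = ζ ^ 2 + 2 * ζ ^ 4 + ζ ^ 6 := by ring
    rw [e]
    linear_combination (2 + ζ ^ 2) * h4

/-- The units of `ℤ/8ℤ` are `1, 3, 5, 7`. [folklore] -/
private theorem units_zmod_eight (u : (ZMod 8)ˣ) :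
    (u : ZMod 8) = 1 ∨ (u : ZMod 8) = 3 ∨ (u : ZMod 8) = 5 ∨ (u : ZMod 8) = 7 := by
  have key : ∀ x : ZMod 8, IsUnit x → x = 1 ∨ x = 3 ∨ x = 5 ∨ x = 7 := by decide
  exact key _ u.isUnit

end Zeta

/-! ## §2 `H`-fixed square roots of rationals descend to `K` -/

section QuadField

variable (K : Type) [Field K] [NumberField K]

/-- The action of `Γ_ℚ` on `ℚ̄` fixes numerals. [folklore] -/
private theorem smul_four (σ : absoluteGaloisGroup ℚ) : σ • (4 : AlgebraicClosure ℚ) = 4 := by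
  rw [Field.absoluteGaloisGroup.smul_def]; exact map_ofNat _ 4

/-- **Galois descent of a square root.** If `x ∈ ℚ̄` has rational square `m` and is fixed by every
element of `Gal(ℚ̄/K) ≤ Γ_ℚ` (the range of the restriction along the chosen embedding `ℚ̄ → K̄`), then `m`
is a square in `K`: the image of `x` in `K̄` is `Γ_K`-fixed, hence in `K` (`K̄/K` Galois).
[cite: MilneFT2022, Ch. 7 (infinite Galois theory: fixed field of the absolute Galois group)] -/
theorem isSquare_algebraMap_of_forall_smul_eq {m : ℚ} {x : AlgebraicClosure ℚ}
    (hx : x ^ 2 = algebraMap ℚ (AlgebraicClosure ℚ) m)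
    (hfix : ∀ τ : absoluteGaloisGroup K, absGaloisRestrict ℚ K τ • x = x) :
    IsSquare (algebraMap ℚ K m) := by
  haveI : IsGalois K (AlgebraicClosure K) := {}
  set y : AlgebraicClosure K := absClosureEmbedding ℚ K x with hy
  have hyfix : ∀ τ : absoluteGaloisGroup K, τ • y = y := fun τ ↦ by
    rw [hy, ← absGaloisRestrict_apply_smul, hfix]
  obtain ⟨k, hk⟩ := (InfiniteGalois.mem_range_algebraMap_iff_fixed y).mpr (fun τ ↦ hyfix τ)
  refine ⟨k, (algebraMap K (AlgebraicClosure K)).injective ?_⟩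
  calc algebraMap K (AlgebraicClosure K) (algebraMap ℚ K m)
        = algebraMap ℚ (AlgebraicClosure K) m := (IsScalarTower.algebraMap_apply ℚ K _ m).symm
    _ = absClosureEmbedding ℚ K (algebraMap ℚ (AlgebraicClosure ℚ) m) :=
        ((absClosureEmbedding ℚ K).commutes m).symm
    _ = y ^ 2 := by rw [← hx, map_pow]
    _ = algebraMap K (AlgebraicClosure K) (k * k) := by rw [map_mul, hk, sq]

/-- Contrapositive form: a non-square `m` in `K` with a square root `x ∈ ℚ̄` is MOVED by some element of
`Gal(ℚ̄/K)`. [folklore] -/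
theorem exists_smul_ne_of_not_isSquare {m : ℚ} (hm : ¬ IsSquare (algebraMap ℚ K m))
    {x : AlgebraicClosure ℚ} (hx : x ^ 2 = algebraMap ℚ (AlgebraicClosure ℚ) m) :
    ∃ τ : absoluteGaloisGroup K, absGaloisRestrict ℚ K τ • x ≠ x := by
  by_contra h
  push Not at h
  exact hm (isSquare_algebraMap_of_forall_smul_eq K hx h)

end QuadField

/-! ## §3 The transposition fixing `ζ₈` -/

section Witness

/-- In `ℤˣ = {±1}`: `p q = 1 ⟹ p = q`. [folklore] -/
private theorem int_units_eq_of_mul_eq_one {p q : ℤˣ} (h : p * q = 1) : p = q := by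
  rcases Int.units_eq_one_or p with rfl | rfl <;> rcases Int.units_eq_one_or q with rfl | rfl <;>
    first | rfl | exact absurd h (by decide)

/-- In `ℤˣ = {±1}`: `p a b = 1 ⟹ p = a b`. [folklore] -/
private theorem int_units_eq_mul_of_mul_mul_eq_one {p a b : ℤˣ} (h : p * a * b = 1) : p = a * b := by
  rcases Int.units_eq_one_or p with rfl | rfl <;> rcases Int.units_eq_one_or a with rfl | rfl <;>
    rcases Int.units_eq_one_or b with rfl | rfl <;> first | rfl | exact absurd h (by decide)

/-- **Over a quadratic field `K` with `2 ∤ d_K` in which none of `Δ, −Δ, 2Δ, −2Δ` is a square, some element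
of `Gal(ℚ̄/K)` acts on the three non-zero `2`-torsion points of `E` by a transposition and has trivial
mod-`8` cyclotomic character** (it fixes `ζ₈`; for `E/ℚ` with `ρ̄_{E,8}` onto this is an element of
`Gal(ℚ̄/K(ζ₈))` mapping to a transvection-class of `GL₂(ℤ/8)`). Proof in the module docstring: otherwise the
sign character of `Gal(ℚ̄/K)` on `E[2]` is one of the four characters of `χ₈(Gal(ℚ̄/K)) = (ℤ/8)ˣ`, and the
matching square root `4δ`, `4δζ₈²`, `4δ(ζ₈ + ζ₈⁷)`, `4δ(ζ₈ + ζ₈³)` of `Δ, −Δ, 2Δ, −2Δ` is fixed by `Gal(ℚ̄/K)`.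
[cite: DokchitserDokchitserMathZ2012, Theorem (1)–(3) and proof (ℚ(E[2]) ⊇ ℚ(√Δ); the conditions Δ ∉ −1·ℚ², ±2·ℚ²)]
[cite: Serre1972, §5.3] -/
theorem exists_sign_permGal_eq_neg_one_and_cyclotomic_eq_one (W : WeierstrassCurve ℚ) [W.IsElliptic]
    (K : Type) [Field K] [NumberField K] (hd : ¬ (2 : ℤ) ∣ NumberField.discr K)
    (hΔ : ¬ IsSquare (algebraMap ℚ K W.Δ)) (hnΔ : ¬ IsSquare (algebraMap ℚ K (-W.Δ)))
    (h2Δ : ¬ IsSquare (algebraMap ℚ K (2 * W.Δ))) (hn2Δ : ¬ IsSquare (algebraMap ℚ K (-2 * W.Δ))) :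
    ∃ τ : absoluteGaloisGroup K,
      Equiv.Perm.sign (permGal W two_ne_zero (absGaloisRestrict ℚ K τ)) = -1 ∧
        modNCyclotomicCharacter ℚ 8 (absGaloisRestrict ℚ K τ) = 1 := by
  haveI : NeZero ((8 : ℕ) : ℚ) := ⟨by norm_num⟩
  haveI : NeZero ((8 : ℕ) : K) := ⟨by norm_num⟩
  haveI : NeZero ((8 : ℕ) : AlgebraicClosure ℚ) := ⟨by norm_num⟩
  obtain ⟨ζ, hζ⟩ := HasEnoughRootsOfUnity.exists_primitiveRoot (AlgebraicClosure ℚ) 8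
  have h2Q : (2 : ℚ) ≠ 0 := two_ne_zero
  -- abbreviations
  set res := absGaloisRestrict ℚ K with hres
  set χ := modNCyclotomicCharacter ℚ 8 with hχ
  set f : absoluteGaloisGroup ℚ → ℤˣ := fun σ ↦ Equiv.Perm.sign (permGal W h2Q σ) with hf
  have hfmul : ∀ σ σ' : absoluteGaloisGroup ℚ, f (σ * σ') = f σ * f σ' := fun σ σ' ↦ by
    simp only [hf, permGal_mul, map_mul]
  have hδ : ∀ σ : absoluteGaloisGroup ℚ,
      σ • delta W h2Q = ((f σ : ℤ) : AlgebraicClosure ℚ) * delta W h2Q := fun σ ↦ smul_delta W h2Q σ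
  have hΔδ : algebraMap ℚ (AlgebraicClosure ℚ) W.Δ = 16 * delta W h2Q ^ 2 := algebraMap_Δ W h2Q
  -- `χ₈` is onto on `Gal(ℚ̄/K)` (`2 ∤ d_K`)
  have hcop : ∀ p : ℕ, p.Prime → p ∣ 8 → ¬ ((p : ℤ) ∣ NumberField.discr K) := by
    intro p hp hp8
    have hp2 : p = 2 :=
      (Nat.prime_dvd_prime_iff_eq hp Nat.prime_two).mp (hp.dvd_of_dvd_pow (show p ∣ 2 ^ 3 from hp8))
    subst hp2
    exact_mod_cast hd
  have hsurjχ : ∀ u : (ZMod 8)ˣ, ∃ τ : absoluteGaloisGroup K, χ (res τ) = u := fun u ↦ by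
    obtain ⟨τ, hτ⟩ := modNCyclotomicCharacter_surjective_of_forall_prime_dvd_not_dvd_discr K 8 hcop u
    exact ⟨τ, by rw [hχ, hres, modNCyclotomicCharacter_absGaloisRestrict ℚ K 8 τ, hτ]⟩
  obtain ⟨τ₃, hτ₃⟩ := hsurjχ (ZMod.unitOfCoprime 3 (by decide))
  obtain ⟨τ₅, hτ₅⟩ := hsurjχ (ZMod.unitOfCoprime 5 (by decide))
  have hτ₃' : ((χ (res τ₃) : (ZMod 8)ˣ) : ZMod 8) = 3 := by
    rw [hτ₃, ZMod.coe_unitOfCoprime, Nat.cast_ofNat]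
  have hτ₅' : ((χ (res τ₅) : (ZMod 8)ˣ) : ZMod 8) = 5 := by
    rw [hτ₅, ZMod.coe_unitOfCoprime, Nat.cast_ofNat]
  -- suppose not
  by_contra hcon
  push Not at hcon
  have hcontra : ∀ τ : absoluteGaloisGroup K, ((χ (res τ) : (ZMod 8)ˣ) : ZMod 8) = 1 → f (res τ) = 1 := by
    intro τ h1
    have h1' : χ (res τ) = 1 := Units.ext (by rw [h1, Units.val_one])
    rcases Int.units_eq_one_or (f (res τ)) with h | h
    · exact h
    · exact absurd h1' (hcon τ h)
  -- the table of `f` on `Gal(ℚ̄/K)` in terms of `χ₈`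
  set a := f (res τ₃) with ha
  set b := f (res τ₅) with hb
  have htab3 : ∀ τ : absoluteGaloisGroup K, ((χ (res τ) : (ZMod 8)ˣ) : ZMod 8) = 3 → f (res τ) = a := by
    intro τ h
    have h1 : ((χ (res (τ * τ₃)) : (ZMod 8)ˣ) : ZMod 8) = 1 := by
      rw [map_mul, map_mul, Units.val_mul, h, hτ₃']; decide
    have := hcontra _ h1
    rw [map_mul, hfmul] at this
    exact int_units_eq_of_mul_eq_one this
  have htab5 : ∀ τ : absoluteGaloisGroup K, ((χ (res τ) : (ZMod 8)ˣ) : ZMod 8) = 5 → f (res τ) = b := by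
    intro τ h
    have h1 : ((χ (res (τ * τ₅)) : (ZMod 8)ˣ) : ZMod 8) = 1 := by
      rw [map_mul, map_mul, Units.val_mul, h, hτ₅']; decide
    have := hcontra _ h1
    rw [map_mul, hfmul] at this
    exact int_units_eq_of_mul_eq_one this
  have htab7 : ∀ τ : absoluteGaloisGroup K, ((χ (res τ) : (ZMod 8)ˣ) : ZMod 8) = 7 →
      f (res τ) = a * b := by
    intro τ h
    have h1 : ((χ (res (τ * τ₃ * τ₅)) : (ZMod 8)ˣ) : ZMod 8) = 1 := by
      rw [map_mul, map_mul, map_mul, map_mul, Units.val_mul, Units.val_mul, h, hτ₃', hτ₅']; decide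
    have := hcontra _ h1
    rw [map_mul, map_mul, hfmul, hfmul] at this
    exact int_units_eq_mul_of_mul_mul_eq_one this
  -- square roots of `Δ, −Δ, 2Δ, −2Δ`
  obtain ⟨hi2, hr2, hm2⟩ := gens_sq hζ
  have hx₁ : (4 * delta W h2Q) ^ 2 = algebraMap ℚ (AlgebraicClosure ℚ) W.Δ := by
    rw [hΔδ]; ring
  have hx₂ : (4 * delta W h2Q * ζ ^ 2) ^ 2 = algebraMap ℚ (AlgebraicClosure ℚ) (-W.Δ) := by
    rw [map_neg, hΔδ, mul_pow, hi2]; ring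
  have hx₃ : (4 * delta W h2Q * (ζ + ζ ^ 7)) ^ 2 = algebraMap ℚ (AlgebraicClosure ℚ) (2 * W.Δ) := by
    rw [map_mul, hΔδ, mul_pow, hr2, map_ofNat]; ring
  have hx₄ : (4 * delta W h2Q * (ζ + ζ ^ 3)) ^ 2 = algebraMap ℚ (AlgebraicClosure ℚ) (-2 * W.Δ) := by
    rw [map_mul, map_neg, hΔδ, mul_pow, hm2, map_ofNat]; ring
  -- the sign `f` as a scalar
  have hfδ : ∀ σ : absoluteGaloisGroup ℚ, f σ = 1 → σ • delta W h2Q = delta W h2Q := fun σ h ↦ by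
    rw [hδ, h, Units.val_one, Int.cast_one, one_mul]
  have hfδ' : ∀ σ : absoluteGaloisGroup ℚ, f σ = -1 → σ • delta W h2Q = -delta W h2Q := fun σ h ↦ by
    rw [hδ, h, Units.val_neg, Units.val_one, Int.cast_neg, Int.cast_one, neg_one_mul]
  -- four cases for `(a, b)`
  rcases Int.units_eq_one_or a with ha1 | ha1 <;> rcases Int.units_eq_one_or b with hb1 | hb1
  · -- `f ≡ 1` on `Gal(ℚ̄/K)`: `4δ = √Δ` is fixed
    obtain ⟨τ, hτ⟩ := exists_smul_ne_of_not_isSquare K hΔ hx₁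
    apply hτ
    have hf1 : f (res τ) = 1 := by
      rcases units_zmod_eight (χ (res τ)) with h | h | h | h
      · exact hcontra τ h
      · rw [htab3 τ h, ha1]
      · rw [htab5 τ h, hb1]
      · rw [htab7 τ h, ha1, hb1, one_mul]
    rw [smul_mul', smul_four, hfδ _ hf1]
  · -- `f = ε₋₂ ∘ χ₈`: `4δ(ζ + ζ³) = √(−2Δ)` is fixed
    obtain ⟨τ, hτ⟩ := exists_smul_ne_of_not_isSquare K hn2Δ hx₄
    apply hτ
    rw [smul_mul', smul_mul', smul_four]
    rcases units_zmod_eight (χ (res τ)) with h | h | h | h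
    · rw [hfδ _ (hcontra τ h), (smul_gens_one hζ _ h).2.2]
    · rw [hfδ _ (by rw [htab3 τ h, ha1]), (smul_gens_three hζ _ h).2.2]
    · rw [hfδ' _ (by rw [htab5 τ h, hb1]), (smul_gens_five hζ _ h).2.2]; ring
    · rw [hfδ' _ (by rw [htab7 τ h, ha1, hb1, one_mul]), (smul_gens_seven hζ _ h).2.2]; ring
  · -- `f = ε₋₁ ∘ χ₈`: `4δζ² = √(−Δ)` is fixed
    obtain ⟨τ, hτ⟩ := exists_smul_ne_of_not_isSquare K hnΔ hx₂
    apply hτ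
    rw [smul_mul', smul_mul', smul_four]
    rcases units_zmod_eight (χ (res τ)) with h | h | h | h
    · rw [hfδ _ (hcontra τ h), (smul_gens_one hζ _ h).1]
    · rw [hfδ' _ (by rw [htab3 τ h, ha1]), (smul_gens_three hζ _ h).1]; ring
    · rw [hfδ _ (by rw [htab5 τ h, hb1]), (smul_gens_five hζ _ h).1]
    · rw [hfδ' _ (by rw [htab7 τ h, ha1, hb1, mul_one]), (smul_gens_seven hζ _ h).1]; ring
  · -- `f = ε₂ ∘ χ₈`: `4δ(ζ + ζ⁷) = √(2Δ)` is fixed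
    obtain ⟨τ, hτ⟩ := exists_smul_ne_of_not_isSquare K h2Δ hx₃
    apply hτ
    rw [smul_mul', smul_mul', smul_four]
    rcases units_zmod_eight (χ (res τ)) with h | h | h | h
    · rw [hfδ _ (hcontra τ h), (smul_gens_one hζ _ h).2.1]
    · rw [hfδ' _ (by rw [htab3 τ h, ha1]), (smul_gens_three hζ _ h).2.1]; ring
    · rw [hfδ' _ (by rw [htab5 τ h, hb1]), (smul_gens_five hζ _ h).2.1]; ring
    · rw [hfδ _ (by rw [htab7 τ h, ha1, hb1]; decide), (smul_gens_seven hζ _ h).2.1]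

end Witness

end Summit.BirchSwinnertonDyer.BirchSwinnertonDyer.Theorems.GenusExact.TwoPowerImageOverK

end
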